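import Literature.Topology.FourManifolds.IntersectionNumbersTarget
import Literature.Topology.FourManifolds.IntersectionNumbersReparam
import Literature.Topology.FourManifolds.MilnorChartSplitting
import Literature.Topology.FourManifolds.SmoothOrientationDiffeomorphProofs
import Mathlib.Geometry.Manifold.ContMDiffMFDeriv
import HarnessLib

/-!
# Local signs of a submanifold against the fibres of a product neighbourhood are constant

Topic `Literature/Topology/FourManifolds` (fact seat
`provefact-Literature.Topology.FourManifolds.Cobordism.Milnor1965_intersectionNumber_slab`, towards
Lemma 7.2 of J. Milnor, *Lectures on the h-cobordism theorem* (1965), in the tree's form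
`Literature.Topology.FourManifolds.Cobordism.Milnor1965_intersectionNumber_slab_of_sphereClass`).
Milnor's Def. 6.1 (PDF p. 36) orients the normal bundle `ν(M')` of `M' = S_R` **once**, and the
local intersection numbers `±1` at the points `pᵢ` compare a positive frame of `M` with that
fixed orientation of the fibre of `ν(M')`; that the comparison does not depend on the point of
`M'` used to read it is built into the notion of an oriented bundle.  In the tree, Def. 6.1 is the
chart formula `Literature.Topology.FourManifolds.localIntersectionSign` (preferred charts at the
three points), and the rôle of the oriented normal bundle at a crossing is played by a
*reference fibre* `q` of a product neighbourhood `Π : A × ℝˡ ⊇ O → V` of the submanifold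
`e = Π(·, 0)` (`IntersectionNumbersNormalProjection.lean`:
`localIntersectionSign_eq_sign_det_normal_mul` expresses the sign of `(e, p)` at a crossing
`e θ = p y` through `sign det d(κ ∘ p)` and the sign of `(e, Π(θ, ·))`).  This file proves that
**the sign of `e` against the fibre `Π(θ, ·)` at `e θ` is a locally constant — on a connected
`A`, constant — function of `θ`**, which is what makes the factor *"attached to the crossing point
and the reference only"* of that lemma a global sign (Milnor's single orientation of `ν(S_R)`):

* `localIntersectionSign_congr_left` — the local sign only depends on the germ of the first map;
* `eventually_det_mfderiv_ne_zero_of_leftInverse`, `eventually_isOrientationPreservingAt_iff_of_contMDiffAt`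
  — a map with a differentiable local left inverse has invertible differential near the point, and
  the clause "`dΨ_u` carries `o u` to `o' (Ψ u)`" is locally constant for such `C¹` maps (the
  pointwise content of Hirsch, *Differential Topology*, §4.4, for local diffeomorphisms; the tree's
  `Diffeomorph.eventually_isOrientationPreservingAt_iff` for global ones);
* `crossingMatrix_lowerEmb_upperEmb` — the crossing matrix of the two coordinate embeddings
  `ℝᵏ → ℝⁿ`, `ℝˡ → ℝⁿ` (`k + l = n`) is the identity;
* **`eventually_localIntersectionSign_prod_eq`**, **`exists_forall_localIntersectionSign_prod_eq`**
  — for `Π : A × ℝˡ → V` which is `C¹` with a `C¹` left inverse near `A × 0`, the sign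
  `θ ↦ localIntersectionSign (Π(·, 0), Π(θ, ·)) (θ, 0)` is locally constant, and constant `= ±1`
  if `A` is connected.  Proof: near `θ₀` read `V` through the local diffeomorphism
  `Ψ(u) = Π(φ₀⁻¹ x⃗(u), y⃗(u))` of `ℝⁿ` (`φ₀ = chartAt θ₀`), under which the two maps become the
  coordinate embeddings composed with the chart transition (`IntersectionNumbersTarget.lean`,
  `localIntersectionSign_comp_target`); the model sign is the orientation character of the chart
  transition, constant near `θ₀` by the defining property `SmoothOrientation.eventually_eq_iff`.

Everything here is proved; no definitions, no named facts.

## References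

* J. Milnor, *Lectures on the h-cobordism theorem*, notes by L. Siebenmann and J. Sondow,
  Princeton Mathematical Notes (1965), Def. 6.1 and Remark 2 (PDF p. 36), proof of Lemma 6.3
  (PDF p. 37), Def. 3.9 (PDF p. 16, the characteristic embedding as product neighbourhood).
  [MilnorHCobordism1965]
* M. W. Hirsch, *Differential Topology*, GTM 33 (1976), Ch. 4 §4 (p. 101). [HirschDT1976]
-/

open scoped Manifold ContDiff Topology
open Set Function Filter Module

noncomputable section

namespace Literature.Topology.FourManifolds

/-! ### The local sign only depends on germs -/

section Congr

variable {a b n : ℕ}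
  {HA : Type*} [TopologicalSpace HA] {IA : ModelWithCorners ℝ (EuclideanSpace ℝ (Fin a)) HA}
  {HB : Type*} [TopologicalSpace HB] {IB : ModelWithCorners ℝ (EuclideanSpace ℝ (Fin b)) HB}
  {HX : Type*} [TopologicalSpace HX] {IX : ModelWithCorners ℝ (EuclideanSpace ℝ (Fin n)) HX}
  {A : Type*} [TopologicalSpace A] [ChartedSpace HA A]
  {B : Type*} [TopologicalSpace B] [ChartedSpace HB B]
  {X : Type*} [TopologicalSpace X] [ChartedSpace HX X]
  [IsManifold IA 1 A] [IsManifold IB 1 B] [IsManifold IX 1 X]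

/-- **The local intersection sign only depends on the germ of the first map at `x`.** [folklore] -/
theorem localIntersectionSign_congr_left (h : a + b = n) (oA : SmoothOrientation IA A)
    (oB : SmoothOrientation IB B) (oX : SmoothOrientation IX X) {s s' : A → X} (p : B → X) {x : A}
    (hs : s =ᶠ[𝓝 x] s') (y : B) :
    localIntersectionSign IA IB IX h oA oB oX s p x y = localIntersectionSign IA IB IX h oA oB oX s' p x y := by
  unfold localIntersectionSign crossingMatrixAt
  rw [hs.mfderiv_eq, hs.self_of_nhds]

/-- **The local intersection sign only depends on the germ of the second map at `y`.** [folklore] -/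
theorem localIntersectionSign_congr_right (h : a + b = n) (oA : SmoothOrientation IA A)
    (oB : SmoothOrientation IB B) (oX : SmoothOrientation IX X) (s : A → X) {p p' : B → X} (x : A)
    {y : B} (hp : p =ᶠ[𝓝 y] p') :
    localIntersectionSign IA IB IX h oA oB oX s p x y = localIntersectionSign IA IB IX h oA oB oX s p' x y := by
  unfold localIntersectionSign crossingMatrixAt
  rw [hp.mfderiv_eq]

end Congr

/-! ### Local diffeomorphisms: invertible differential, local constancy of the orientation clause -/

section LocalDiffeo

variable {E H H' : Type*} [NormedAddCommGroup E] [NormedSpace ℝ E] [TopologicalSpace H]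
  [TopologicalSpace H'] {I : ModelWithCorners ℝ E H} {I' : ModelWithCorners ℝ E H'}
  {M : Type*} [TopologicalSpace M] [ChartedSpace H M]
  {N : Type*} [TopologicalSpace N] [ChartedSpace H' N]

/-- **A differentiable map with a differentiable local left inverse has differential of non-zero
determinant near the point** (chain rule on `Ψ' ∘ Ψ = id`). [folklore] -/
theorem eventually_det_mfderiv_ne_zero_of_leftInverse {Ψ : M → N} {Ψ' : N → M} {x₀ : M}
    (hinv : ∀ᶠ x in 𝓝 x₀, Ψ' (Ψ x) = x) (hd : ∀ᶠ x in 𝓝 x₀, MDifferentiableAt I I' Ψ x)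
    (hd' : ∀ᶠ x in 𝓝 x₀, MDifferentiableAt I' I Ψ' (Ψ x)) :
    ∀ᶠ x in 𝓝 x₀, LinearMap.det (M := E) (mfderiv I I' Ψ x).toLinearMap ≠ 0 := by
  filter_upwards [eventually_eventually_nhds.2 hinv, hd, hd'] with x hx hdx hdx'
  have h1 : mfderiv I I (Ψ' ∘ Ψ) x = (mfderiv I' I Ψ' (Ψ x)).comp (mfderiv I I' Ψ x) :=
    mfderiv_comp x hdx' hdx
  have h2 : mfderiv I I (Ψ' ∘ Ψ) x = mfderiv I I id x :=
    Filter.EventuallyEq.mfderiv_eq (hx.mono fun y hy => hy)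
  rw [h2, mfderiv_id] at h1
  exact right_ne_zero_of_mul_eq_one (det_mul_det_eq_one_of_comp_eq_id h1.symm)

variable [IsManifold I 1 M] [IsManifold I' 1 N]

/-- **Local constancy of "`dΨ_x` carries `oM x` to `oN (Ψ x)`" for a `C¹` map with invertible
differential near `x`** (Hirsch 1976, Ch. 4 §4: for a local diffeomorphism this clause is locally
constant; the tree's `Diffeomorph.eventually_isOrientationPreservingAt_iff` is the case of a global
diffeomorphism, whose proof is followed here). [cite: HirschDT1976, §4.4 p. 101] -/
theorem eventually_isOrientationPreservingAt_iff_of_contMDiffAt {φ : M → N} {x : M}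
    (hφ : ContMDiffAt I I' 1 φ x)
    (hdet : ∀ᶠ y in 𝓝 x, LinearMap.det (M := E) (mfderiv I I' φ y).toLinearMap ≠ 0)
    (oM : SmoothOrientation I M) (oN : SmoothOrientation I' N) :
    ∀ᶠ y in 𝓝 x,
      ((oN (φ y) = oM y ↔ 0 < LinearMap.det (M := E) (mfderiv I I' φ y).toLinearMap) ↔
        (oN (φ x) = oM x ↔ 0 < LinearMap.det (M := E) (mfderiv I I' φ x).toLinearMap)) := by
  have hφc : ContinuousAt φ x := hφ.continuousAt
  set dφ : M → E →L[ℝ] E := fun y => (mfderiv I I' φ y : E →L[ℝ] E) with hdφ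
  have hd0x : LinearMap.det (M := E) (dφ x : E →ₗ[ℝ] E) ≠ 0 := hdet.self_of_nhds
  have h1 := oM.eventually_eq_iff x
  have h2 := hφc.eventually (oN.eventually_eq_iff (φ x))
  have h3 : ∀ᶠ y in 𝓝 x, y ∈ (extChartAt I x).source := extChartAt_source_mem_nhds x
  have h3' : ∀ᶠ y in 𝓝 x, φ y ∈ (extChartAt I' (φ x)).source :=
    hφc.eventually (extChartAt_source_mem_nhds (φ x))
  set G : M → E →L[ℝ] E := inTangentCoordinates I I' id φ dφ x with hG_def
  have hG : ContinuousAt G x := by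
    have h := hφ.mfderiv_const (m := 0) (by norm_num)
    exact h.continuousAt
  have hGdet : ContinuousAt (fun y => LinearMap.det (M := E) (G y : E →ₗ[ℝ] E)) x :=
    (ContinuousLinearMap.continuous_det.continuousAt).comp hG
  have hGeq : ∀ y, y ∈ (extChartAt I x).source → φ y ∈ (extChartAt I' (φ x)).source →
      G y = (tangentCoordChange I' (φ y) (φ x) (φ y)).comp
        ((dφ y).comp (tangentCoordChange I x y y)) := by
    intro y hy hy'
    rw [extChartAt_source] at hy hy'
    exact inTangentCoordinates_eq id φ dφ (x₀ := x) (x := y) hy hy'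
  have hGx : LinearMap.det (M := E) (G x : E →ₗ[ℝ] E) = LinearMap.det (M := E) (dφ x).toLinearMap := by
    have hx := mem_extChartAt_source (I := I) x
    have hx' := mem_extChartAt_source (I := I') (φ x)
    rw [hGeq x hx hx', det_comp_comp, det_tangentCoordChange_self hx,
      det_tangentCoordChange_self hx', one_mul, mul_one]
  have h4 : ∀ᶠ y in 𝓝 x, (0 < LinearMap.det (M := E) (G y : E →ₗ[ℝ] E) ↔
      0 < LinearMap.det (M := E) (dφ x).toLinearMap) := by
    rw [← hGx]
    have hGx0 : LinearMap.det (M := E) (G x : E →ₗ[ℝ] E) ≠ 0 := hGx ▸ hd0x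
    rcases lt_or_gt_of_ne hGx0 with h | h
    · filter_upwards [hGdet.eventually (gt_mem_nhds h)] with y hy
      exact iff_of_false (lt_asymm hy) (lt_asymm h)
    · filter_upwards [hGdet.eventually (lt_mem_nhds h)] with y hy
      exact iff_of_true hy h
  filter_upwards [h1, h2, h3, h3', h4, hdet] with y hA hB hy hy' hD hd0y'
  have hd0y : LinearMap.det (M := E) (dφ y : E →ₗ[ℝ] E) ≠ 0 := hd0y'
  have hyM := mem_extChartAt_source (I := I) y
  have hyN := mem_extChartAt_source (I := I') (φ y)
  have pM := det_tangentCoordChange_mul_det_tangentCoordChange hy hyM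
  have pN := det_tangentCoordChange_mul_det_tangentCoordChange hy' hyN
  have hp0 := right_ne_zero_of_mul_eq_one pM
  have hp'0 := left_ne_zero_of_mul_eq_one pM
  have hq0 := right_ne_zero_of_mul_eq_one pN
  have hP := (mul_pos_iff_pos_iff_pos hp'0 hp0).mp (pM ▸ one_pos)
  rw [hGeq y hy hy', det_comp_comp, mul_pos_iff_pos_iff_pos hq0 (mul_ne_zero hd0y hp'0),
    mul_pos_iff_pos_iff_pos hd0y hp'0] at hD
  exact isOrientationPreservingAt_bookkeeping (orientation_eq_iff_eq_iff_eq _ (oN (φ x)) _)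
    (orientation_eq_iff_eq_iff_eq _ (oM x) _) (eq_comm.trans hA) hB hP hD

end LocalDiffeo

/-! ### The crossing matrix of the coordinate embeddings is the identity -/

section Model

variable {k l n : ℕ}

/-- **`[lowerEmb | upperEmb] = 1`**: the crossing matrix of the coordinate embeddings
`x ↦ (x, 0) : ℝᵏ → ℝⁿ` and `y ↦ (0, y) : ℝˡ → ℝⁿ`, `k + l = n`, is the identity matrix. [folklore] -/
theorem crossingMatrix_lowerEmb_upperEmb (h : k + l = n) :
    crossingMatrix h ((lowerEmb k n : EuclideanSpace ℝ (Fin k) →L[ℝ] EuclideanSpace ℝ (Fin n)) : _ →ₗ[ℝ] _)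
      ((upperEmb k l n : EuclideanSpace ℝ (Fin l) →L[ℝ] EuclideanSpace ℝ (Fin n)) : _ →ₗ[ℝ] _) = 1 := by
  ext i c
  obtain ⟨c', rfl⟩ := (finSumFinEquiv.trans (finCongr h)).surjective c
  rcases c' with j | j
  · rw [Equiv.trans_apply, crossingMatrix_apply_inl, Matrix.one_apply]
    simp only [ContinuousLinearMap.coe_coe, lowerEmb_apply, finSumFinEquiv_apply_left, finCongr_apply,
      Fin.ext_iff, Fin.val_cast, Fin.val_castAdd]
    by_cases hi : (i : ℕ) < k
    · rw [dif_pos hi, PiLp.single_apply]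
      simp only [Fin.ext_iff]
    · rw [dif_neg hi, if_neg]
      intro hij
      exact hi (hij ▸ j.2)
  · rw [Equiv.trans_apply, crossingMatrix_apply_inr, Matrix.one_apply]
    simp only [ContinuousLinearMap.coe_coe, upperEmb_apply, finSumFinEquiv_apply_right, finCongr_apply,
      Fin.ext_iff, Fin.val_cast, Fin.val_natAdd]
    by_cases hi : k ≤ (i : ℕ) ∧ (i : ℕ) - k < l
    · rw [dif_pos hi, PiLp.single_apply]
      simp only [Fin.ext_iff]
      split_ifs <;> first | rfl | omega
    · rw [dif_neg hi, if_neg]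
      intro hij
      exact hi ⟨by omega, by omega⟩

/-- Hence `det [lowerEmb ∘ T | upperEmb] = det T` for every endomorphism `T` of `ℝᵏ`. [folklore] -/
theorem det_crossingMatrix_lowerEmb_comp_upperEmb (h : k + l = n)
    (T : EuclideanSpace ℝ (Fin k) →ₗ[ℝ] EuclideanSpace ℝ (Fin k)) :
    (crossingMatrix h (((lowerEmb k n : EuclideanSpace ℝ (Fin k) →L[ℝ] EuclideanSpace ℝ (Fin n)) : _ →ₗ[ℝ] _) ∘ₗ T)
      ((upperEmb k l n : EuclideanSpace ℝ (Fin l) →L[ℝ] EuclideanSpace ℝ (Fin n)) : _ →ₗ[ℝ] _)).det =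
      LinearMap.det T := by
  rw [det_crossingMatrix_comp_left, crossingMatrix_lowerEmb_upperEmb h, Matrix.det_one, one_mul]

/-- The orientation character bookkeeping: if `o y = o x ↔ 0 < d` with `d ≠ 0` then
`sign d · ε(o y) = ε(o x)`. [folklore] -/
theorem sign_mul_orientationSign_eq {m : ℕ} {ox oy : Orientation ℝ (EuclideanSpace ℝ (Fin m)) (Fin (finrank ℝ (EuclideanSpace ℝ (Fin m))))}
    {d : ℝ} (hd : d ≠ 0) (h : oy = ox ↔ 0 < d) :
    (SignType.sign d : ℤ) * orientationSign oy = orientationSign ox := by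
  rcases lt_or_gt_of_ne hd with hlt | hgt
  · have hne : ox ≠ oy := fun e => absurd (h.1 e.symm) (not_lt.2 hlt.le)
    rw [sign_neg hlt, orientationSign_eq_neg_of_ne hne]
    simp
  · rw [sign_pos hgt, h.2 hgt]
    simp

end Model

/-! ### The sign of a submanifold against the fibres of a product neighbourhood -/

section ProductDefs

/-- **The fibre of the product neighbourhood through `θ`**: `w ↦ Π(θ, w)`. [cite: MilnorHCobordism1965, Def. 3.9 (PDF p. 16)] -/
abbrev prodFibre {l : ℕ} {A V : Type*} (Pf : A × EuclideanSpace ℝ (Fin l) → V) (θ : A) :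
    EuclideanSpace ℝ (Fin l) → V := fun w => Pf (θ, w)

/-- **The zero section of the product neighbourhood**: `θ ↦ Π(θ, 0)`. [cite: MilnorHCobordism1965, Def. 3.9 (PDF p. 16)] -/
abbrev prodZero {l : ℕ} {A V : Type*} (Pf : A × EuclideanSpace ℝ (Fin l) → V) : A → V := fun θ => Pf (θ, 0)

/-- `Ψ_{θ₀}(u) = Π(φ₀⁻¹ (x⃗ u), y⃗ u)`, `φ₀` the extended chart at `θ₀`. [folklore] -/
abbrev prodChartMap {l n : ℕ} (k : ℕ) {A : Type*} [TopologicalSpace A] [ChartedSpace (EuclideanSpace ℝ (Fin k)) A]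
    {V : Type*} (Pf : A × EuclideanSpace ℝ (Fin l) → V) (θ₀ : A) (u : EuclideanSpace ℝ (Fin n)) : V :=
  Pf ((extChartAt (𝓡 k) θ₀).symm (lowerProj k n u), upperProj k l n u)

/-- Its left inverse `v ↦ (φ₀ (Pinv v).1, (Pinv v).2)` read in `ℝⁿ`. [folklore] -/
abbrev prodChartInv {l n : ℕ} (k : ℕ) {A : Type*} [TopologicalSpace A] [ChartedSpace (EuclideanSpace ℝ (Fin k)) A]
    {V : Type*} (Pinv : V → A × EuclideanSpace ℝ (Fin l)) (θ₀ : A) (v : V) : EuclideanSpace ℝ (Fin n) :=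
  lowerEmb k n (extChartAt (𝓡 k) θ₀ (Pinv v).1) + upperEmb k l n (Pinv v).2

/-- The point of `ℝⁿ` over `θ` in the chart at `θ₀`: `s₀ θ = (φ₀ θ, 0)`. [folklore] -/
abbrev prodChartPt (k n : ℕ) {A : Type*} [TopologicalSpace A] [ChartedSpace (EuclideanSpace ℝ (Fin k)) A]
    (θ₀ θ : A) : EuclideanSpace ℝ (Fin n) :=
  lowerEmb k n (extChartAt (𝓡 k) θ₀ θ)

end ProductDefs

section Product

variable {k l n : ℕ}
  {A : Type*} [TopologicalSpace A] [ChartedSpace (EuclideanSpace ℝ (Fin k)) A]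
  {V : Type*} [TopologicalSpace V] [ChartedSpace (EuclideanSpace ℝ (Fin n)) V]

/-- **Local signs read through a local diffeomorphism of the target, both cases at once**: at a
double point `v = s x = p y` where `dΨ_v` is invertible, the local sign of `(Ψ ∘ s, Ψ ∘ p)` is
`χ · ` the local sign of `(s, p)`, `χ = ±1` according as `dΨ_v` carries `oX v` to `oX' (Ψ v)` or
not (`localIntersectionSign_comp_target`, `…_of_neg`). [cite: MilnorHCobordism1965, Def. 6.1 and Remark 2 (PDF p. 36)] -/
theorem localIntersectionSign_comp_target_eq_ite {a b : ℕ}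
    {HA : Type*} [TopologicalSpace HA] {IA : ModelWithCorners ℝ (EuclideanSpace ℝ (Fin a)) HA}
    {HB : Type*} [TopologicalSpace HB] {IB : ModelWithCorners ℝ (EuclideanSpace ℝ (Fin b)) HB}
    {HX : Type*} [TopologicalSpace HX] {IX : ModelWithCorners ℝ (EuclideanSpace ℝ (Fin n)) HX}
    {HX' : Type*} [TopologicalSpace HX'] {IX' : ModelWithCorners ℝ (EuclideanSpace ℝ (Fin n)) HX'}
    {A' : Type*} [TopologicalSpace A'] [ChartedSpace HA A'] [IsManifold IA 1 A']
    {B' : Type*} [TopologicalSpace B'] [ChartedSpace HB B'] [IsManifold IB 1 B']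
    {X : Type*} [TopologicalSpace X] [ChartedSpace HX X] [IsManifold IX 1 X]
    {X' : Type*} [TopologicalSpace X'] [ChartedSpace HX' X'] [IsManifold IX' 1 X']
    (h : a + b = n) (oA : SmoothOrientation IA A') (oB : SmoothOrientation IB B')
    (oX : SmoothOrientation IX X) (oX' : SmoothOrientation IX' X')
    {s : A' → X} {p : B' → X} {Ψ : X → X'} {x : A'} {y : B'} (hxy : s x = p y)
    (hΨ : MDifferentiableAt IX IX' Ψ (s x)) (hs : MDifferentiableAt IA IX s x)
    (hp : MDifferentiableAt IB IX p y)
    (hdet : LinearMap.det (M := EuclideanSpace ℝ (Fin n)) (mfderiv IX IX' Ψ (s x)).toLinearMap ≠ 0)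
    [Decidable (oX' (Ψ (s x)) = oX (s x) ↔
      0 < LinearMap.det (M := EuclideanSpace ℝ (Fin n)) (mfderiv IX IX' Ψ (s x)).toLinearMap)] :
    localIntersectionSign IA IB IX' h oA oB oX' (Ψ ∘ s) (Ψ ∘ p) x y =
      (if (oX' (Ψ (s x)) = oX (s x) ↔
          0 < LinearMap.det (M := EuclideanSpace ℝ (Fin n)) (mfderiv IX IX' Ψ (s x)).toLinearMap)
        then 1 else -1) * localIntersectionSign IA IB IX h oA oB oX s p x y := by
  split_ifs with hor
  · rw [one_mul]
    exact localIntersectionSign_comp_target h oA oB hxy hΨ hs hp hdet hor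
  · rw [neg_one_mul]
    refine localIntersectionSign_comp_target_of_neg h oA oB hxy hΨ hs hp hdet ?_
    rw [SmoothOrientation.neg_apply]
    rcases orientation_eq_or_eq_neg (oX' (Ψ (s x))) (oX (s x)) with h1 | h1
    · have h2 : ¬ (0 < LinearMap.det (M := EuclideanSpace ℝ (Fin n)) (mfderiv IX IX' Ψ (s x)).toLinearMap) :=
        fun hpos => hor (iff_of_true h1 hpos)
      refine iff_of_false ?_ h2
      rw [h1]
      exact fun e => Module.Ray.ne_neg_self (oX (s x)) e.symm
    · have hne : oX' (Ψ (s x)) ≠ oX (s x) := by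
        rw [h1]
        exact fun e => Module.Ray.ne_neg_self (oX (s x)) e.symm
      have h2 : 0 < LinearMap.det (M := EuclideanSpace ℝ (Fin n)) (mfderiv IX IX' Ψ (s x)).toLinearMap := by
        by_contra hneg
        exact hor (iff_of_false hne hneg)
      refine iff_of_true ?_ h2
      rw [h1]
      exact neg_neg (oX (s x))

variable [IsManifold (𝓡 k) ∞ A] [IsManifold (𝓡 n) ∞ V] {Pf : A × (EuclideanSpace ℝ (Fin l)) → V}

omit [IsManifold (𝓡 k) ∞ A] [IsManifold (𝓡 n) ∞ V] in
/-- The zero section is differentiable (for `Π` of class `C¹` on an open `O ⊇ A × 0`). [folklore] -/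
theorem mdifferentiableAt_prodZero {O : Set (A × (EuclideanSpace ℝ (Fin l)))} (hO : IsOpen O) (hO0 : ∀ θ, (θ, (0 : (EuclideanSpace ℝ (Fin l)))) ∈ O)
    (hPf : ContMDiffOn ((𝓡 k).prod 𝓘(ℝ, (EuclideanSpace ℝ (Fin l)))) (𝓡 n) 1 Pf O) (θ : A) :
    MDifferentiableAt (𝓡 k) (𝓡 n) (prodZero Pf) θ := by
  have h1 : ContMDiffAt (𝓡 k) ((𝓡 k).prod 𝓘(ℝ, (EuclideanSpace ℝ (Fin l)))) 1 (fun θ : A => ((θ, (0 : (EuclideanSpace ℝ (Fin l)))) : A × (EuclideanSpace ℝ (Fin l)))) θ :=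
    contMDiffAt_id.prodMk contMDiffAt_const
  exact ((hPf.contMDiffAt (hO.mem_nhds (hO0 θ))).comp θ h1).mdifferentiableAt one_ne_zero

omit [IsManifold (𝓡 k) ∞ A] [IsManifold (𝓡 n) ∞ V] in
/-- The fibres are differentiable at the zero section. [folklore] -/
theorem mdifferentiableAt_prodFibre {O : Set (A × (EuclideanSpace ℝ (Fin l)))} (hO : IsOpen O) (hO0 : ∀ θ, (θ, (0 : (EuclideanSpace ℝ (Fin l)))) ∈ O)
    (hPf : ContMDiffOn ((𝓡 k).prod 𝓘(ℝ, (EuclideanSpace ℝ (Fin l)))) (𝓡 n) 1 Pf O) (θ : A) :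
    MDifferentiableAt 𝓘(ℝ, (EuclideanSpace ℝ (Fin l))) (𝓡 n) (prodFibre Pf θ) 0 := by
  have h1 : ContMDiffAt 𝓘(ℝ, (EuclideanSpace ℝ (Fin l))) ((𝓡 k).prod 𝓘(ℝ, (EuclideanSpace ℝ (Fin l)))) 1 (fun w : (EuclideanSpace ℝ (Fin l)) => ((θ, w) : A × (EuclideanSpace ℝ (Fin l)))) 0 :=
    contMDiffAt_const.prodMk contMDiffAt_id
  exact ((hPf.contMDiffAt (hO.mem_nhds (hO0 θ))).comp (0 : (EuclideanSpace ℝ (Fin l))) h1).mdifferentiableAt one_ne_zero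

/-! #### The local diffeomorphism `Ψ(u) = Π(φ₀⁻¹ x⃗(u), y⃗(u))` attached to the chart at `θ₀` -/

omit [IsManifold (𝓡 k) ∞ A] [IsManifold (𝓡 n) ∞ V] [TopologicalSpace V] [ChartedSpace (EuclideanSpace ℝ (Fin n)) V] in
/-- `Ψ (s₀ θ) = Π(θ, 0)` for `θ` in the chart domain (`k + l = n`). [folklore] -/
theorem prodChartMap_prodChartPt (h : k + l = n) {θ₀ θ : A} (hθ : θ ∈ (chartAt (EuclideanSpace ℝ (Fin k)) θ₀).source) :
    prodChartMap k Pf θ₀ (prodChartPt k n θ₀ θ) = prodZero Pf θ := by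
  have hkn : k ≤ n := by omega
  rw [← extChartAt_source (𝓡 k)] at hθ
  change Pf ((extChartAt (𝓡 k) θ₀).symm (lowerProj k n (lowerEmb k n (extChartAt (𝓡 k) θ₀ θ))),
    upperProj k l n (lowerEmb k n (extChartAt (𝓡 k) θ₀ θ))) = Pf (θ, 0)
  rw [lowerProj_lowerEmb hkn, upperProj_lowerEmb, (extChartAt (𝓡 k) θ₀).left_inv hθ]

omit [IsManifold (𝓡 k) ∞ A] [IsManifold (𝓡 n) ∞ V] [TopologicalSpace V] [ChartedSpace (EuclideanSpace ℝ (Fin n)) V] in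
/-- `Ψ ∘ (w ↦ s₀ θ + (0, w)) = Π(θ, ·)` for `θ` in the chart domain. [folklore] -/
theorem prodChartMap_comp_eq_prodFibre (h : k + l = n) {θ₀ θ : A} (hθ : θ ∈ (chartAt (EuclideanSpace ℝ (Fin k)) θ₀).source) :
    (prodChartMap k Pf θ₀ ∘ fun w : (EuclideanSpace ℝ (Fin l)) => prodChartPt k n θ₀ θ + upperEmb k l n w) = prodFibre Pf θ := by
  have hkn : k ≤ n := by omega
  rw [← extChartAt_source (𝓡 k)] at hθ
  funext w
  change Pf ((extChartAt (𝓡 k) θ₀).symm (lowerProj k n (lowerEmb k n (extChartAt (𝓡 k) θ₀ θ) + upperEmb k l n w)),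
    upperProj k l n (lowerEmb k n (extChartAt (𝓡 k) θ₀ θ) + upperEmb k l n w)) = Pf (θ, w)
  rw [lowerProj_lowerEmb_add_upperEmb hkn, upperProj_lowerEmb_add_upperEmb h.le, (extChartAt (𝓡 k) θ₀).left_inv hθ]

omit [IsManifold (𝓡 k) ∞ A] [IsManifold (𝓡 n) ∞ V] [TopologicalSpace V] [ChartedSpace (EuclideanSpace ℝ (Fin n)) V] in
/-- Near `θ₀`, the zero section is `Ψ ∘ s₀` (as germs at every `θ` of the chart domain). [folklore] -/
theorem prodZero_eventuallyEq (h : k + l = n) {θ₀ θ : A} (hθ : θ ∈ (chartAt (EuclideanSpace ℝ (Fin k)) θ₀).source) :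
    prodZero Pf =ᶠ[𝓝 θ] (prodChartMap k Pf θ₀ ∘ prodChartPt k n θ₀) := by
  filter_upwards [(chartAt (EuclideanSpace ℝ (Fin k)) θ₀).open_source.mem_nhds hθ] with θ' hθ'
  exact (prodChartMap_prodChartPt h hθ').symm

omit [IsManifold (𝓡 n) ∞ V] in
/-- **`Ψ` is `C¹` at the points `u` with `x⃗ u ∈ φ₀.target` and `(φ₀⁻¹ x⃗ u, y⃗ u) ∈ O`.** [folklore] -/
theorem contMDiffAt_prodChartMap {O : Set (A × (EuclideanSpace ℝ (Fin l)))} (hO : IsOpen O)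
    (hPf : ContMDiffOn ((𝓡 k).prod 𝓘(ℝ, (EuclideanSpace ℝ (Fin l)))) (𝓡 n) 1 Pf O)
    {θ₀ : A} {u : (EuclideanSpace ℝ (Fin n))} (hu : lowerProj k n u ∈ (extChartAt (𝓡 k) θ₀).target)
    (huO : ((extChartAt (𝓡 k) θ₀).symm (lowerProj k n u), upperProj k l n u) ∈ O) :
    ContMDiffAt 𝓘(ℝ, (EuclideanSpace ℝ (Fin n))) (𝓡 n) 1 (prodChartMap k Pf θ₀) u := by
  have h1 : ContMDiffAt 𝓘(ℝ, (EuclideanSpace ℝ (Fin n))) (𝓡 k) 1 (fun u : (EuclideanSpace ℝ (Fin n)) => (extChartAt (𝓡 k) θ₀).symm (lowerProj k n u)) u := by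
    have hs : ContMDiffAt 𝓘(ℝ, (EuclideanSpace ℝ (Fin k))) (𝓡 k) 1 (extChartAt (𝓡 k) θ₀).symm (lowerProj k n u) :=
      (contMDiffOn_extChartAt_symm (n := 1) θ₀ _ hu).contMDiffAt ((isOpen_extChartAt_target θ₀).mem_nhds hu)
    exact hs.comp u ((lowerProj k n).contDiff.contMDiff u)
  have h2 : ContMDiffAt 𝓘(ℝ, (EuclideanSpace ℝ (Fin n))) 𝓘(ℝ, (EuclideanSpace ℝ (Fin l))) 1 (fun u : (EuclideanSpace ℝ (Fin n)) => upperProj k l n u) u :=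
    (upperProj k l n).contDiff.contMDiff u
  exact (hPf.contMDiffAt (hO.mem_nhds huO)).comp u (h1.prodMk h2)

omit [IsManifold (𝓡 k) ∞ A] [IsManifold (𝓡 n) ∞ V] in
/-- `x⃗ (s₀ θ) = φ₀ θ ∈ φ₀.target` and `(φ₀⁻¹ x⃗, y⃗)(s₀ θ) = (θ, 0)` for `θ` in the chart domain. [folklore] -/
theorem lowerProj_prodChartPt (h : k + l = n) {θ₀ θ : A} (hθ : θ ∈ (chartAt (EuclideanSpace ℝ (Fin k)) θ₀).source) :
    lowerProj k n (prodChartPt k n θ₀ θ) ∈ (extChartAt (𝓡 k) θ₀).target ∧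
      ((extChartAt (𝓡 k) θ₀).symm (lowerProj k n (prodChartPt k n θ₀ θ)), upperProj k l n (prodChartPt k n θ₀ θ)) =
        (θ, 0) := by
  have hkn : k ≤ n := by omega
  rw [← extChartAt_source (𝓡 k)] at hθ
  change lowerProj k n (lowerEmb k n (extChartAt (𝓡 k) θ₀ θ)) ∈ _ ∧
    ((extChartAt (𝓡 k) θ₀).symm (lowerProj k n (lowerEmb k n (extChartAt (𝓡 k) θ₀ θ))),
      upperProj k l n (lowerEmb k n (extChartAt (𝓡 k) θ₀ θ))) = (θ, 0)
  rw [lowerProj_lowerEmb hkn, upperProj_lowerEmb, (extChartAt (𝓡 k) θ₀).left_inv hθ]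
  exact ⟨(extChartAt (𝓡 k) θ₀).map_source hθ, rfl⟩

omit [IsManifold (𝓡 n) ∞ V] in
/-- **`dΨ_u` has non-zero determinant for `u` near `s₀ θ₀`** (`Ψ` has the differentiable local
left inverse `v ↦ (φ₀ (Pinv v).1, (Pinv v).2)`). [folklore] -/
theorem eventually_det_mfderiv_prodChartMap_ne_zero (h : k + l = n) {O : Set (A × (EuclideanSpace ℝ (Fin l)))} (hO : IsOpen O)
    (hO0 : ∀ θ, (θ, (0 : (EuclideanSpace ℝ (Fin l)))) ∈ O) (hPf : ContMDiffOn ((𝓡 k).prod 𝓘(ℝ, (EuclideanSpace ℝ (Fin l)))) (𝓡 n) 1 Pf O)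
    {Pinv : V → A × (EuclideanSpace ℝ (Fin l))} (hinv : ∀ p ∈ O, Pinv (Pf p) = p)
    (hPinv : ∀ p ∈ O, ContMDiffAt (𝓡 n) ((𝓡 k).prod 𝓘(ℝ, (EuclideanSpace ℝ (Fin l)))) 1 Pinv (Pf p)) (θ₀ : A) :
    ∀ᶠ u in 𝓝 (prodChartPt k n θ₀ θ₀),
      LinearMap.det (M := (EuclideanSpace ℝ (Fin n))) (mfderiv 𝓘(ℝ, (EuclideanSpace ℝ (Fin n))) (𝓡 n) (prodChartMap k Pf θ₀) u).toLinearMap ≠ 0 := by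
  have hθ₀ : θ₀ ∈ (chartAt (EuclideanSpace ℝ (Fin k)) θ₀).source := mem_chart_source (EuclideanSpace ℝ (Fin k)) θ₀
  obtain ⟨htgt, hG0⟩ := lowerProj_prodChartPt (l := l) h hθ₀
  -- the set of good points `u`: `x⃗ u ∈ φ₀.target`, `G u ∈ O`
  have hGc : ContinuousAt (fun u : (EuclideanSpace ℝ (Fin n)) => ((extChartAt (𝓡 k) θ₀).symm (lowerProj k n u), upperProj k l n u))
      (prodChartPt k n θ₀ θ₀) :=
    ((((continuousOn_extChartAt_symm θ₀) _ htgt).continuousAt ((isOpen_extChartAt_target θ₀).mem_nhds htgt)).comp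
      (lowerProj k n).continuous.continuousAt).prodMk (upperProj k l n).continuous.continuousAt
  have hev1 : ∀ᶠ u in 𝓝 (prodChartPt k n θ₀ θ₀), lowerProj k n u ∈ (extChartAt (𝓡 k) θ₀).target :=
    (lowerProj k n).continuous.continuousAt.preimage_mem_nhds ((isOpen_extChartAt_target θ₀).mem_nhds htgt)
  have hev2 : ∀ᶠ u in 𝓝 (prodChartPt k n θ₀ θ₀),
      ((extChartAt (𝓡 k) θ₀).symm (lowerProj k n u), upperProj k l n u) ∈ O :=
    hGc.preimage_mem_nhds (hO.mem_nhds (by rw [hG0]; exact hO0 θ₀))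
  refine eventually_det_mfderiv_ne_zero_of_leftInverse (Ψ' := prodChartInv k Pinv θ₀) ?_ ?_ ?_
  · filter_upwards [hev1, hev2] with u hu huO
    change lowerEmb k n (extChartAt (𝓡 k) θ₀ (Pinv (Pf _)).1) + upperEmb k l n (Pinv (Pf _)).2 = u
    rw [hinv _ huO]
    dsimp only
    rw [(extChartAt (𝓡 k) θ₀).right_inv hu]
    exact lowerEmb_lowerProj_add_upperEmb_upperProj h u
  · filter_upwards [hev1, hev2] with u hu huO
    exact (contMDiffAt_prodChartMap hO hPf hu huO).mdifferentiableAt one_ne_zero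
  · filter_upwards [hev1, hev2] with u hu huO
    have h1 : ContMDiffAt (𝓡 n) ((𝓡 k).prod 𝓘(ℝ, (EuclideanSpace ℝ (Fin l)))) 1 Pinv (prodChartMap k Pf θ₀ u) := hPinv _ huO
    have hsrc : (Pinv (prodChartMap k Pf θ₀ u)).1 ∈ (chartAt (EuclideanSpace ℝ (Fin k)) θ₀).source := by
      change (Pinv (Pf _)).1 ∈ _
      rw [hinv _ huO, ← extChartAt_source (𝓡 k)]
      exact (extChartAt (𝓡 k) θ₀).map_target hu
    have hfst : ContMDiffAt (𝓡 n) (𝓡 k) 1 (fun v => (Pinv v).1) (prodChartMap k Pf θ₀ u) :=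
      contMDiffAt_fst.comp (prodChartMap k Pf θ₀ u) h1
    have ha : ContMDiffAt (𝓡 n) 𝓘(ℝ, (EuclideanSpace ℝ (Fin k))) 1 (fun v => extChartAt (𝓡 k) θ₀ (Pinv v).1) (prodChartMap k Pf θ₀ u) :=
      (contMDiffAt_extChartAt' (I := 𝓡 k) (n := 1) hsrc).comp (prodChartMap k Pf θ₀ u) hfst
    have hb : ContMDiffAt (𝓡 n) 𝓘(ℝ, (EuclideanSpace ℝ (Fin l))) 1 (fun v => (Pinv v).2) (prodChartMap k Pf θ₀ u) :=
      contMDiffAt_snd.comp _ h1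
    have h2 : ContMDiffAt (𝓡 n) 𝓘(ℝ, (EuclideanSpace ℝ (Fin n))) 1 (prodChartInv k Pinv θ₀) (prodChartMap k Pf θ₀ u) :=
      ((lowerEmb k n).contDiff.comp_contMDiffAt ha).add ((upperEmb k l n).contDiff.comp_contMDiffAt hb)
    exact h2.mdifferentiableAt one_ne_zero

/-! #### The model sign `[s₀, p_θ]` in `ℝⁿ` is the orientation character of the chart transition -/

omit [IsManifold (𝓡 n) ∞ V] [ChartedSpace (EuclideanSpace ℝ (Fin n)) V] [TopologicalSpace V] in
/-- **The crossing determinant of `(s₀, p_θ)` at `(θ, 0)` is the Jacobian of the chart transition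
`θ → θ₀`** (`s₀ = (φ₀, 0)`, `p_θ = s₀ θ + (0, ·)`; `d s₀ = lowerEmb ∘ τ(θ → θ₀)`, `d p_θ = upperEmb`,
and `[lowerEmb ∘ T | upperEmb] = det T`). [folklore] -/
theorem det_crossingMatrixAt_prodChartPt (h : k + l = n) {θ₀ θ : A} (hθ : θ ∈ (chartAt (EuclideanSpace ℝ (Fin k)) θ₀).source) :
    (crossingMatrixAt (𝓡 k) 𝓘(ℝ, (EuclideanSpace ℝ (Fin l))) 𝓘(ℝ, (EuclideanSpace ℝ (Fin n))) h (prodChartPt k n θ₀)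
        (fun w : (EuclideanSpace ℝ (Fin l)) => prodChartPt k n θ₀ θ + upperEmb k l n w) θ 0).det =
      LinearMap.det (M := (EuclideanSpace ℝ (Fin k))) (tangentCoordChange (𝓡 k) θ θ₀ θ : (EuclideanSpace ℝ (Fin k)) →ₗ[ℝ] (EuclideanSpace ℝ (Fin k))) := by
  -- `d s₀_θ = lowerEmb ∘ τ(θ → θ₀)`
  have hθ' : θ ∈ (extChartAt (𝓡 k) θ₀).source := by rwa [extChartAt_source]
  have hd1 : HasMFDerivAt (𝓡 k) 𝓘(ℝ, (EuclideanSpace ℝ (Fin k))) (extChartAt (𝓡 k) θ₀) θ (tangentCoordChange (𝓡 k) θ θ₀ θ) := by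
    refine ⟨(contMDiffAt_extChartAt' (I := 𝓡 k) (n := 1) hθ).continuousAt, ?_⟩
    have hw : writtenInExtChartAt (𝓡 k) 𝓘(ℝ, (EuclideanSpace ℝ (Fin k))) θ (extChartAt (𝓡 k) θ₀) =
        (extChartAt (𝓡 k) θ₀) ∘ (extChartAt (𝓡 k) θ).symm := by
      funext v; simp [writtenInExtChartAt]
    rw [hw]
    exact hasFDerivWithinAt_tangentCoordChange ⟨mem_extChartAt_source θ, hθ'⟩
  have hs : mfderiv (𝓡 k) 𝓘(ℝ, (EuclideanSpace ℝ (Fin n))) (prodChartPt k n θ₀) θ =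
      (lowerEmb k n : (EuclideanSpace ℝ (Fin k)) →L[ℝ] (EuclideanSpace ℝ (Fin n))).comp (tangentCoordChange (𝓡 k) θ θ₀ θ) := by
    have h2 : HasMFDerivAt 𝓘(ℝ, (EuclideanSpace ℝ (Fin k))) 𝓘(ℝ, (EuclideanSpace ℝ (Fin n))) (lowerEmb k n : (EuclideanSpace ℝ (Fin k)) → (EuclideanSpace ℝ (Fin n))) (extChartAt (𝓡 k) θ₀ θ)
        (lowerEmb k n : (EuclideanSpace ℝ (Fin k)) →L[ℝ] (EuclideanSpace ℝ (Fin n))) :=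
      hasMFDerivAt_iff_hasFDerivAt.2 (lowerEmb k n).hasFDerivAt
    exact (h2.comp θ hd1).mfderiv
  -- `d p_θ = upperEmb`
  have hp : mfderiv 𝓘(ℝ, (EuclideanSpace ℝ (Fin l))) 𝓘(ℝ, (EuclideanSpace ℝ (Fin n))) (fun w : (EuclideanSpace ℝ (Fin l)) => prodChartPt k n θ₀ θ + upperEmb k l n w) 0 =
      (upperEmb k l n : (EuclideanSpace ℝ (Fin l)) →L[ℝ] (EuclideanSpace ℝ (Fin n))) := by
    have h3 : HasFDerivAt (fun w : (EuclideanSpace ℝ (Fin l)) => prodChartPt k n θ₀ θ + upperEmb k l n w) (upperEmb k l n : (EuclideanSpace ℝ (Fin l)) →L[ℝ] (EuclideanSpace ℝ (Fin n))) 0 :=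
      ((upperEmb k l n).hasFDerivAt).const_add _
    exact (hasMFDerivAt_iff_hasFDerivAt.2 h3).mfderiv
  unfold crossingMatrixAt
  rw [hs, hp]
  exact det_crossingMatrix_lowerEmb_comp_upperEmb h _

omit [IsManifold (𝓡 n) ∞ V] [ChartedSpace (EuclideanSpace ℝ (Fin n)) V] [TopologicalSpace V] in
/-- **The model sign is `ε(o θ₀)` near `θ₀`**: for `θ` near `θ₀`, the local sign of `(s₀, p_θ)` at
`(θ, 0)` in `ℝⁿ` (orientations `o` on `A`, standard on `ℝˡ`, `ℝⁿ`) is the orientation character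
of `o θ₀` (`SmoothOrientation.eventually_eq_iff`: `o θ = o θ₀ ↔ 0 < det τ(θ → θ₀)`). [cite: HirschDT1976, §4.4 p. 101] -/
theorem eventually_localIntersectionSign_model_eq (h : k + l = n) (o : SmoothOrientation (𝓡 k) A) (θ₀ : A) :
    ∀ᶠ θ in 𝓝 θ₀,
      localIntersectionSign (𝓡 k) 𝓘(ℝ, (EuclideanSpace ℝ (Fin l))) 𝓘(ℝ, (EuclideanSpace ℝ (Fin n))) h o (SmoothOrientation.euclidean l)
          (SmoothOrientation.euclidean n) (prodChartPt k n θ₀) (fun w : (EuclideanSpace ℝ (Fin l)) => prodChartPt k n θ₀ θ + upperEmb k l n w) θ 0 =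
        orientationSign (o θ₀) := by
  filter_upwards [o.eventually_eq_iff θ₀, (chartAt (EuclideanSpace ℝ (Fin k)) θ₀).open_source.mem_nhds (mem_chart_source (EuclideanSpace ℝ (Fin k)) θ₀)]
    with θ hθ hθs
  have hθ' : θ ∈ (extChartAt (𝓡 k) θ₀).source := by rwa [extChartAt_source]
  have hdet0 : LinearMap.det (M := (EuclideanSpace ℝ (Fin k))) (tangentCoordChange (𝓡 k) θ θ₀ θ : (EuclideanSpace ℝ (Fin k)) →ₗ[ℝ] (EuclideanSpace ℝ (Fin k))) ≠ 0 :=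
    left_ne_zero_of_mul_eq_one (det_tangentCoordChange_mul_det_tangentCoordChange (mem_extChartAt_source θ) hθ')
  unfold localIntersectionSign
  rw [det_crossingMatrixAt_prodChartPt h hθs, SmoothOrientation.euclidean_apply, SmoothOrientation.euclidean_apply,
    orientationSign_euclideanOrientation, orientationSign_euclideanOrientation, mul_one, mul_one]
  exact sign_mul_orientationSign_eq hdet0 hθ

/-! #### Local constancy -/

/-- **The sign of the zero section against the fibre through `θ`, at `θ`, is a locally constant
function of `θ`** (Milnor 1965, Def. 6.1: the local sign compares a positive frame of `M` with
*one* orientation of the fibre of `ν(M')`).  For a `C¹` product neighbourhood `Π : A × ℝˡ ⊇ O → V`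
of `e = Π(·, 0)` with a `C¹` local left inverse, and any orientations `oA`, `oV`:
`θ ↦ localIntersectionSign (e, Π(θ, ·)) (θ, 0)` (standard orientation on `ℝˡ`) is locally constant.
[cite: MilnorHCobordism1965, Def. 6.1 and Remark 2 (PDF p. 36); HirschDT1976, §4.4 p. 101] -/
theorem eventually_localIntersectionSign_prod_eq (h : k + l = n) {O : Set (A × (EuclideanSpace ℝ (Fin l)))} (hO : IsOpen O)
    (hO0 : ∀ θ, (θ, (0 : (EuclideanSpace ℝ (Fin l)))) ∈ O) (hPf : ContMDiffOn ((𝓡 k).prod 𝓘(ℝ, (EuclideanSpace ℝ (Fin l)))) (𝓡 n) 1 Pf O)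
    {Pinv : V → A × (EuclideanSpace ℝ (Fin l))} (hinv : ∀ p ∈ O, Pinv (Pf p) = p)
    (hPinv : ∀ p ∈ O, ContMDiffAt (𝓡 n) ((𝓡 k).prod 𝓘(ℝ, (EuclideanSpace ℝ (Fin l)))) 1 Pinv (Pf p))
    (oA : SmoothOrientation (𝓡 k) A) (oV : SmoothOrientation (𝓡 n) V) (θ₀ : A) :
    ∀ᶠ θ in 𝓝 θ₀,
      localIntersectionSign (𝓡 k) 𝓘(ℝ, (EuclideanSpace ℝ (Fin l))) (𝓡 n) h oA (SmoothOrientation.euclidean l) oV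
          (prodZero Pf) (prodFibre Pf θ) θ 0 =
        localIntersectionSign (𝓡 k) 𝓘(ℝ, (EuclideanSpace ℝ (Fin l))) (𝓡 n) h oA (SmoothOrientation.euclidean l) oV
          (prodZero Pf) (prodFibre Pf θ₀) θ₀ 0 := by
  classical
  have hθ₀ : θ₀ ∈ (chartAt (EuclideanSpace ℝ (Fin k)) θ₀).source := mem_chart_source (EuclideanSpace ℝ (Fin k)) θ₀
  set Ψ := prodChartMap k Pf θ₀ with hΨdef
  obtain ⟨htgt, hG0⟩ := lowerProj_prodChartPt (l := l) h hθ₀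
  have hΨc : ContMDiffAt 𝓘(ℝ, (EuclideanSpace ℝ (Fin n))) (𝓡 n) 1 Ψ (prodChartPt k n θ₀ θ₀) :=
    contMDiffAt_prodChartMap hO hPf htgt (by rw [hG0]; exact hO0 θ₀)
  have hdet := eventually_det_mfderiv_prodChartMap_ne_zero h hO hO0 hPf hinv hPinv θ₀
  -- the orientation clause of `Ψ` is locally constant near `u₀`; pull back along `s₀`
  have hclause := eventually_isOrientationPreservingAt_iff_of_contMDiffAt hΨc hdet
    (SmoothOrientation.euclidean n) oV
  have hs₀c : ContinuousAt (prodChartPt k n θ₀ : A → (EuclideanSpace ℝ (Fin n))) θ₀ :=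
    (lowerEmb k n).continuous.continuousAt.comp (contMDiffAt_extChartAt' (I := 𝓡 k) (n := 1) hθ₀).continuousAt
  have hclause' := hs₀c.eventually hclause
  have hdet' := hs₀c.eventually hdet
  have hΨc' : ∀ᶠ θ in 𝓝 θ₀, ContMDiffAt 𝓘(ℝ, (EuclideanSpace ℝ (Fin n))) (𝓡 n) 1 Ψ (prodChartPt k n θ₀ θ) :=
    hs₀c.eventually ((contMDiffAt_iff_contMDiffAt_nhds (by decide)).1 hΨc)
  have hmodel := eventually_localIntersectionSign_model_eq (l := l) (n := n) h oA θ₀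
  -- the formula `sign(θ) = χ(s₀ θ) · ε(oA θ₀)` near `θ₀`
  have key : ∀ᶠ θ in 𝓝 θ₀,
      localIntersectionSign (𝓡 k) 𝓘(ℝ, (EuclideanSpace ℝ (Fin l))) (𝓡 n) h oA (SmoothOrientation.euclidean l) oV
          (prodZero Pf) (prodFibre Pf θ) θ 0 =
        (if (oV (Ψ (prodChartPt k n θ₀ θ)) = SmoothOrientation.euclidean n (prodChartPt k n θ₀ θ) ↔
            0 < LinearMap.det (M := (EuclideanSpace ℝ (Fin n))) (mfderiv 𝓘(ℝ, (EuclideanSpace ℝ (Fin n))) (𝓡 n) Ψ (prodChartPt k n θ₀ θ)).toLinearMap)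
          then 1 else -1) * orientationSign (oA θ₀) := by
    filter_upwards [(chartAt (EuclideanSpace ℝ (Fin k)) θ₀).open_source.mem_nhds hθ₀, hdet', hΨc', hmodel] with θ hθ hdθ hΨθ hmθ
    rw [localIntersectionSign_congr_left h oA (SmoothOrientation.euclidean l) oV (prodFibre Pf θ)
      (prodZero_eventuallyEq h hθ) 0, ← prodChartMap_comp_eq_prodFibre h hθ]
    have hsd : MDifferentiableAt (𝓡 k) 𝓘(ℝ, (EuclideanSpace ℝ (Fin n))) (prodChartPt k n θ₀ : A → (EuclideanSpace ℝ (Fin n))) θ :=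
      ((lowerEmb k n).contDiff.comp_contMDiffAt (contMDiffAt_extChartAt' (n := 1) hθ)).mdifferentiableAt one_ne_zero
    have hpd : MDifferentiableAt 𝓘(ℝ, (EuclideanSpace ℝ (Fin l))) 𝓘(ℝ, (EuclideanSpace ℝ (Fin n))) (fun w : (EuclideanSpace ℝ (Fin l)) => prodChartPt k n θ₀ θ + upperEmb k l n w) 0 :=
      (hasMFDerivAt_iff_hasFDerivAt.2 (((upperEmb k l n).hasFDerivAt).const_add _)).mdifferentiableAt
    have hxy : prodChartPt k n θ₀ θ = (fun w : (EuclideanSpace ℝ (Fin l)) => prodChartPt k n θ₀ θ + upperEmb k l n w) 0 := by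
      simp only [map_zero, add_zero]
    rw [localIntersectionSign_comp_target_eq_ite h oA (SmoothOrientation.euclidean l)
      (SmoothOrientation.euclidean n) oV hxy (hΨθ.mdifferentiableAt one_ne_zero) hsd hpd hdθ, hmθ]
  -- conclude: both sides of the claim equal the locally constant expression
  have key0 := key.self_of_nhds
  filter_upwards [key, hclause'] with θ hkθ hcθ
  rw [hkθ, key0]
  congr 1
  exact if_congr hcθ rfl rfl

/-- **On a connected `A` the sign against the fibres is constant and equal to `±1`.**  In the
situation of `eventually_localIntersectionSign_prod_eq` with `A` connected and non-empty, there is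
`c = ±1` with `localIntersectionSign (Π(·, 0), Π(θ, ·)) (θ, 0) = c` for all `θ` (locally constant on
a connected space; the value is `±1` because the zero section and the fibre are transverse at
`θ`, their crossing matrix being `dΨ ∘ [lowerEmb ∘ τ | upperEmb]`). This is the tree's form of the
single orientation of `ν(S_R)` in Milnor's Def. 6.1. [cite: MilnorHCobordism1965, Def. 6.1 and Remark 2 (PDF p. 36); HirschDT1976, §4.4 p. 101] -/
theorem exists_forall_localIntersectionSign_prod_eq [ConnectedSpace A] (h : k + l = n)
    {O : Set (A × (EuclideanSpace ℝ (Fin l)))} (hO : IsOpen O) (hO0 : ∀ θ, (θ, (0 : (EuclideanSpace ℝ (Fin l)))) ∈ O)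
    (hPf : ContMDiffOn ((𝓡 k).prod 𝓘(ℝ, (EuclideanSpace ℝ (Fin l)))) (𝓡 n) 1 Pf O)
    {Pinv : V → A × (EuclideanSpace ℝ (Fin l))} (hinv : ∀ p ∈ O, Pinv (Pf p) = p)
    (hPinv : ∀ p ∈ O, ContMDiffAt (𝓡 n) ((𝓡 k).prod 𝓘(ℝ, (EuclideanSpace ℝ (Fin l)))) 1 Pinv (Pf p))
    (oA : SmoothOrientation (𝓡 k) A) (oV : SmoothOrientation (𝓡 n) V) :
    ∃ c : ℤ, (c = 1 ∨ c = -1) ∧ ∀ θ : A,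
      localIntersectionSign (𝓡 k) 𝓘(ℝ, (EuclideanSpace ℝ (Fin l))) (𝓡 n) h oA (SmoothOrientation.euclidean l) oV
          (prodZero Pf) (prodFibre Pf θ) θ 0 = c := by
  classical
  set σ : A → ℤ := fun θ => localIntersectionSign (𝓡 k) 𝓘(ℝ, (EuclideanSpace ℝ (Fin l))) (𝓡 n) h oA (SmoothOrientation.euclidean l) oV
    (prodZero Pf) (prodFibre Pf θ) θ 0 with hσ
  -- locally constant, hence constant
  have hloc : IsLocallyConstant σ := by
    refine (IsLocallyConstant.iff_eventually_eq σ).2 fun θ₀ => ?_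
    exact eventually_localIntersectionSign_prod_eq h hO hO0 hPf hinv hPinv oA oV θ₀
  -- the value at any point is `±1`
  have hval : ∀ θ₀, σ θ₀ = 1 ∨ σ θ₀ = -1 := by
    intro θ₀
    have hθ₀ : θ₀ ∈ (chartAt (EuclideanSpace ℝ (Fin k)) θ₀).source := mem_chart_source (EuclideanSpace ℝ (Fin k)) θ₀
    obtain ⟨htgt, hG0⟩ := lowerProj_prodChartPt (l := l) h hθ₀
    have hΨc : ContMDiffAt 𝓘(ℝ, (EuclideanSpace ℝ (Fin n))) (𝓡 n) 1 (prodChartMap k Pf θ₀) (prodChartPt k n θ₀ θ₀) :=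
      contMDiffAt_prodChartMap hO hPf htgt (by rw [hG0]; exact hO0 θ₀)
    have hdet := (eventually_det_mfderiv_prodChartMap_ne_zero h hO hO0 hPf hinv hPinv θ₀).self_of_nhds
    have hmodel := (eventually_localIntersectionSign_model_eq (l := l) (n := n) h oA θ₀).self_of_nhds
    have hsd : MDifferentiableAt (𝓡 k) 𝓘(ℝ, (EuclideanSpace ℝ (Fin n))) (prodChartPt k n θ₀ : A → (EuclideanSpace ℝ (Fin n))) θ₀ :=
      ((lowerEmb k n).contDiff.comp_contMDiffAt (contMDiffAt_extChartAt' (n := 1) hθ₀)).mdifferentiableAt one_ne_zero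
    have hpd : MDifferentiableAt 𝓘(ℝ, (EuclideanSpace ℝ (Fin l))) 𝓘(ℝ, (EuclideanSpace ℝ (Fin n))) (fun w : (EuclideanSpace ℝ (Fin l)) => prodChartPt k n θ₀ θ₀ + upperEmb k l n w) 0 :=
      (hasMFDerivAt_iff_hasFDerivAt.2 (((upperEmb k l n).hasFDerivAt).const_add _)).mdifferentiableAt
    have hxy : prodChartPt k n θ₀ θ₀ = (fun w : (EuclideanSpace ℝ (Fin l)) => prodChartPt k n θ₀ θ₀ + upperEmb k l n w) 0 := by
      simp only [map_zero, add_zero]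
    have e1 : σ θ₀ = (if (oV (prodChartMap k Pf θ₀ (prodChartPt k n θ₀ θ₀)) =
          SmoothOrientation.euclidean n (prodChartPt k n θ₀ θ₀) ↔
            0 < LinearMap.det (M := (EuclideanSpace ℝ (Fin n)))
              (mfderiv 𝓘(ℝ, (EuclideanSpace ℝ (Fin n))) (𝓡 n) (prodChartMap k Pf θ₀) (prodChartPt k n θ₀ θ₀)).toLinearMap)
          then 1 else -1) * orientationSign (oA θ₀) := by
      change localIntersectionSign (𝓡 k) 𝓘(ℝ, (EuclideanSpace ℝ (Fin l))) (𝓡 n) h oA (SmoothOrientation.euclidean l) oV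
        (prodZero Pf) (prodFibre Pf θ₀) θ₀ 0 = _
      rw [localIntersectionSign_congr_left h oA (SmoothOrientation.euclidean l) oV (prodFibre Pf θ₀)
        (prodZero_eventuallyEq h hθ₀) 0, ← prodChartMap_comp_eq_prodFibre h hθ₀,
        localIntersectionSign_comp_target_eq_ite h oA (SmoothOrientation.euclidean l)
          (SmoothOrientation.euclidean n) oV hxy (hΨc.mdifferentiableAt one_ne_zero) hsd hpd hdet, hmodel]
    rw [e1]
    rcases orientationSign_eq_one_or_eq_neg_one (oA θ₀) with h1 | h1 <;> rw [h1] <;> split_ifs <;> simp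
  obtain ⟨θ₀⟩ := (inferInstance : Nonempty A)
  refine ⟨σ θ₀, hval θ₀, fun θ => ?_⟩
  exact hloc.apply_eq_of_isPreconnected isPreconnected_univ (mem_univ θ) (mem_univ θ₀)

end Product

end Literature.Topology.FourManifolds

end
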